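import Summits.BirchSwinnertonDyer.BirchSwinnertonDyer.Theorems.KolyvaginDepthDoorDepthTableSteinWuthrichRankThree
import Summits.BirchSwinnertonDyer.BirchSwinnertonDyer.Theorems.KolyvaginDepthDoorDepthTableSteinWuthrichRankThree5077a1TwistLValue
import HarnessLib

/-!
# Route `KolyvaginDepthDoor`, crux `KolyvaginDepthSupplyKN` (stmt-BirchSwinnertonDyer-22820) —
# DEPTH TABLE v14: the EXACT odd-rank row `5077a1` at `(5, −7)` — body ⟺ twist condition; bit ⟺ one twist-Selmer
# bound; and the crux at `5077a1` from ONE twist bound at ANY admissible prime (uniform in `p`)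

Helper file of the lead prover of line `levelone` (kdd-p1 g18; `--supports stmt-BirchSwinnertonDyer-22820
--as helper`); it closes nothing and BSD is NOT proved by it.

Sequel of `KolyvaginDepthDoorDepthTableSteinWuthrichRankThree` (`5077a1`: `Ш(E)[5] = 0` by name, the crux's clause
modulo ONE twist bound, the rank-zero currency lemma). Here the two-sided rows, as for the other eight rank-3 curves
(`…RankThree<label>`): g14's exact readings on W. Zhang's ♠ cell with the `E`-side conjunct `Ш(E)[5] = 0` DISCHARGED
by Stein–Wuthrich Thm. 1.1 —

* `C5077a1.exactBody_5_neg7_iff_twistCondition` — the `∃`-body of `KolyvaginDepthSupplyKN` at `(5077a1, 5, K)`,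
  `d_K = −7`, `↔` the twist condition `#Sel_5(E^{(−7)}) ≤ 5^{rank E} ∨ (Ш(E^{(−7)})[5] = 0 ∧ rank E^{(−7)} = rank E + 1)`
  ALONE: at Gross–Zagier's curve the crux is a statement about the RANK-ZERO twist `E^{(−7)}` (`L(E^{(−7)},1) ≈ 4.48`).
* `C5077a1.exactRowDepth_5_neg7_iff_twistSelmer` — the row at depth `rank − 1`: bit `↔` `#Sel_5(E^{(−7)}) ≤ 5^{rank − 1}`
  (with `rank = 3`: «`dim Sel_5(E^{(−7)}) ≤ 2`», i.e. for the rank-zero twist «`#Ш(E^{(−7)})[5] ≤ 25`»).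
* UNIFORM IN THE ADMISSIBLE PRIME (g17's `…Uniform389a1` pattern): `kodairaNeron_of_five_le`, `spadeOne_of_prime`,
  `sha_inf_torsionBy_eq_bot_at` (`Ш(E)[p] = 0` by name at every good ordinary surjective `5 ≤ p < 1000`), and
  `cruxBody_of_twistSelmer_at` — the crux's clause at `5077a1` from ONE bound `#Sel_p(E^{(−7)}/ℚ) ≤ p³` at ANY admissible
  `p < 1000`, `p ≠ 7`: the rank-zero datum may be taken at whichever prime is prime to the algebraic part of `L(E^{(−7)},1)`;
  `cruxBody_of_twistSelmer_at_of_heegner` — the same at ANY Heegner field `K` (`d_K ∉ {−3,−4}`, `p ∤ d_K`): prime AND field free.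

* `C5077a1.cruxBody_of_twistLValue` — **the crux at `5077a1` from ONE exact `L`-value**: granted SW Thm. 1.1, W. Zhang L8.4 (1),
  Skinner 2016 Thm. C and GZK by name, the clause holds at `5077a1` as soon as Gross–Zagier's twist `T = E^{(−7)}` has
  `L(T,1) ≠ 0` and `ord_5(L(T,1)/Ω_T) ≤ 0` (`…RankThree5077a1TwistLValue`: Skinner's `5`-part of BSD for the rank-zero twist ⟹
  `#Sel_5(T) = 1`) — the anticyclotomic depth door at the first rank-3 curve read through the cyclotomic main conjecture of its twist.

CONDITIONAL on (γ) = Gross 1991 Prop. 3.7 (2), W. Zhang 2014 Lemma 8.4 (1) / Thm. 9.1, Stein–Wuthrich 2013 Thm. 1.1 and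
(last theorem) Skinner 2016 Thm. C + Gross–Zagier–Kolyvagin, BY NAME; per curve; nothing class-wide; BSD is NOT proved by any of this.

References: [SteinWuthrich2013] Thm. 1.1 (p. 1758); [WZhang2014] Lemma 8.4 (1) (p. 236), Thm. 9.1 (p. 240);
[GrossLMS1991] Prop. 3.7 (2); [GrossZagier1986] §V.4; [CremonaAlgorithms1997] Table 1 (5077a1).
-/

set_option linter.dupNamespace false

noncomputable section

open scoped Classical NumberField

namespace Summit.BirchSwinnertonDyer.BirchSwinnertonDyer.Theorems.KolyvaginDepthDoor

open Literature.NumberTheory.EllipticCurves Literature.NumberTheory.EllipticCurves.ModularForms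
  WeierstrassCurve NumberField IsDedekindDomain
open Summit.BirchSwinnertonDyer.BirchSwinnertonDyer.Theorems
open Summit.BirchSwinnertonDyer.BirchSwinnertonDyer.Rank2Observatory
open Summit.BirchSwinnertonDyer.BirchSwinnertonDyer.Rank1Residual
open Summit.BirchSwinnertonDyer.Rank1Residual.Additive

namespace C5077a1

/-- **EXACT READING OF THE CRUX AT `5077a1`, `(p, d_K) = (5, -7)` — the `∃`-body ⟺ THE TWIST CONDITION ALONE.**
For `E = 5077a1` (rank `3`, ♠ cell, `5` admissible) and ANY imaginary quadratic `K` with `d_K = -7`: «∃ frame,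
square-free product `n₁` of Kolyvagin primes, datum: `c_1(n₁) ≠ 0` ∧ the signed rank clause» (the body of
`KolyvaginDepthSupplyKN` at `(E, 5, K)`) `↔` «`#Sel_5(E^{(d_K)}/ℚ) ≤ 5^{rank E}` ∨ (`Ш(E^{(d_K)}/ℚ)[5] = 0` ∧
`rank E^{(d_K)} = rank E + 1`)» — the lineage's exact reading on the ♠ cell
(`kolyvaginClass_rankClause_iff_shaTrivial_twistCondition_of_lemma84`, g14) with its `E`-side conjunct `Ш(E)[5] = 0`
DISCHARGED by Stein–Wuthrich Thm. 1.1 (`sha_inf_torsionBy_five_eq_bot`): at this odd-rank curve the crux's content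
is a statement about ONE quadratic twist of even analytic rank and nothing else. CONDITIONAL on (γ), W. Zhang L8.4 (1) /
9.1 and SW Thm. 1.1 by name; per curve; BSD is not proved by it. [cite: SteinWuthrich2013, Thm. 1.1 (p. 1758)]
[cite: WZhang2014, Lemma 8.4 (1) (p. 236), Thm. 9.1 (p. 240)] [cite: GrossLMS1991, Prop. 3.7 (2)] [cite: SilvermanAEC2009, Thm. X.4.2] -/
theorem exactBody_5_neg7_iff_twistCondition
    (hSW : SteinWuthrich2013_sha_inf_torsionBy_eq_bot_of_two_le_rank)
    (h372 : GrossLMS1991.prop37_2_frobeniusCongruence)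
    (h84 : Literature.NumberTheory.EllipticCurves.WZhang2014_lemma84_exists_minimal_kolyvaginClass_one_selmerCard)
    (K : Type) [Field K] [NumberField K] (hK : IsImaginaryQuadratic K)
    (hD : NumberField.discr K = -7) :
    haveI := isElliptic_of_mem_atlasR3A00 mem_atlas;
    haveI := isGloballyMinimal_of_mem_atlasR3A00 mem_atlas;
    haveI : NeZero ((c5077a1.e.baseChange ℚ).conductorNorm ℤ) := neZero_conductorNorm_of_isElliptic _;
    haveI := Fact.mk (by norm_num : Nat.Prime 5);
    (∃ (Dt : ModularParametrizationData (c5077a1.e.baseChange ℚ) ((c5077a1.e.baseChange ℚ).conductorNorm ℤ)) (β : ℤ) (ι : K →+* ℂ) (n₁ : ℕ)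
      (d : KolyvaginHeegnerData Dt β ι n₁), Squarefree n₁ ∧
        (∀ q ∈ n₁.primeFactors, Zhang2014.IsKolyvaginPrime ((c5077a1.e.baseChange ℚ).conductorNorm ℤ) (c5077a1.e.baseChange ℚ) K 5 q) ∧
        d.kolyvaginClass (p := 5) (by norm_num) 1 ≠ 0 ∧
        (n₁.primeFactors.card + 1 ≤ (c5077a1.e.baseChange ℚ).mordellWeilRank ∨
          (n₁.primeFactors.card ≤ (c5077a1.e.baseChange ℚ).mordellWeilRank ∧
            n₁.primeFactors.card + 1 ≤ ((c5077a1.e.baseChange ℚ).quadraticTwist (NumberField.discr K : ℚ)).mordellWeilRank))) ↔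
    (Nat.card (((c5077a1.e.baseChange ℚ).quadraticTwist (NumberField.discr K : ℚ)).selmerGroup (5 : ℕ)) ≤ 5 ^ (c5077a1.e.baseChange ℚ).mordellWeilRank ∨
      ((((c5077a1.e.baseChange ℚ).quadraticTwist (NumberField.discr K : ℚ)).sha ⊓
          AddSubgroup.torsionBy ((c5077a1.e.baseChange ℚ).quadraticTwist (NumberField.discr K : ℚ)).galH1 ((5 : ℕ) : ℤ) :
          AddSubgroup ((c5077a1.e.baseChange ℚ).quadraticTwist (NumberField.discr K : ℚ)).galH1) = ⊥ ∧
        ((c5077a1.e.baseChange ℚ).quadraticTwist (NumberField.discr K : ℚ)).mordellWeilRank = (c5077a1.e.baseChange ℚ).mordellWeilRank + 1)) := by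
  haveI := isElliptic_of_mem_atlasR3A00 mem_atlas
  haveI := isGloballyMinimal_of_mem_atlasR3A00 mem_atlas
  haveI iNZ : NeZero ((c5077a1.e.baseChange ℚ).conductorNorm ℤ) := neZero_conductorNorm_of_isElliptic _
  haveI i5 := Fact.mk (by norm_num : Nat.Prime 5)
  have hsp := spade_5
  have hKN : ∀ v : HeightOneSpectrum (𝓞 ℚ), (c5077a1.e.baseChange ℚ).HasMultiplicativeReductionAt v →
      ¬ 5 ∣ (c5077a1.e.baseChange ℚ).ordMinimalDiscriminant v :=
    not_dvd_ordMinimalDiscriminant_of_intModel_table intModel (p := 5) (Δ₀ := 5077) (by decide +kernel)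
      (B := 8) (by decide +kernel) (by decide +kernel)
  have hS2 : ¬ Squarefree ((c5077a1.e.baseChange ℚ).conductorNorm ℤ) →
      (∃ (ℓ : ℕ) (_ : Fact ℓ.Prime), (c5077a1.e.baseChange ℚ).HasMultiplicativeReductionAtPrime ℓ ∧
          ¬ 5 ∣ padicValInt ℓ (c5077a1.e.baseChange ℚ).minimalDiscriminantInt) ∧
        ∃ (ℓ₁ ℓ₂ : ℕ) (_ : Fact ℓ₁.Prime) (_ : Fact ℓ₂.Prime), ℓ₁ ≠ ℓ₂ ∧
          (c5077a1.e.baseChange ℚ).HasMultiplicativeReductionAtPrime ℓ₁ ∧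
            (c5077a1.e.baseChange ℚ).HasMultiplicativeReductionAtPrime ℓ₂ :=
    fun hns ↦ absurd ((c5077a1.e.baseChange ℚ).isSemistable_iff_squarefree_conductorNorm.mp hsp.2) hns
  have hH := satisfiesHeegnerHypothesis_conductorNorm_of_intModel intModel K hK.1 hD heegner_neg7
  have hD3 : NumberField.discr K ≠ -3 := by rw [hD]; norm_num
  have hD4 : NumberField.discr K ≠ -4 := by rw [hD]; norm_num
  have hpD : ¬ (((5 : ℕ) : ℤ) ∣ NumberField.discr K) := by rw [hD]; norm_num
  have hr3 : 3 ≤ (c5077a1.e.baseChange ℚ).mordellWeilRank := three_le_rank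
  exact (kolyvaginClass_rankClause_iff_shaTrivial_twistCondition_of_lemma84 h372 h84 _ not_hasCM 5 (by norm_num)
    goodOrdinary_5.1 goodOrdinary_5.2 hasSurjectiveModNGaloisRep_pow_5 hKN hsp.1 hS2 K hK hD3 hD4 hpD hH).trans
    (and_iff_right (sha_inf_torsionBy_five_eq_bot hSW))

/-- **DEPTH-TABLE ROW `5077a1`, `(p, d_K) = (5, -7)`, at depth `rank − 1`, v14 — «ONE BIT ⟺ ONE TWIST-SELMER BOUND».**
For `E = 5077a1` and ANY imaginary quadratic `K` with `d_K = -7`: «∃ frame, square-free product `n₁` of `rank E − 1`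
Kolyvagin primes, datum: `c_1(n₁) ≠ 0`» `↔` «`#Sel_5(E^{(d_K)}/ℚ) ≤ 5^{rank E − 1}`» — the lineage's depth row on
the ♠ cell (`kolyvaginClass_depth_ne_zero_iff_shaTrivial_twistSelmer_of_lemma84`, g14) with `Ш(E)[5] = 0` DISCHARGED by
SW Thm. 1.1. With `rank E = 3` (the tree holds `3 ≤ rank`) the bit a depth-`2` computation would find is EXACTLY
«`dim_𝔽₅ Sel_5(E^{(d_K)}) ≤ 2`»; for a twist of analytic rank `0` (no `5`-torsion: `E^{(d)}[5]` is irreducible)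
that is «`#Ш(E^{(d_K)}/ℚ)[5] ≤ 25`». CONDITIONAL on (γ), W. Zhang L8.4 (1) / 9.1 and SW Thm. 1.1 by name; per curve;
BSD is not proved by it. [cite: SteinWuthrich2013, Thm. 1.1 (p. 1758)] [cite: WZhang2014, Lemma 8.4 (1) (p. 236)]
[cite: GrossLMS1991, Prop. 3.7 (2), §5 (5.1)] [cite: Kolyvagin1991MathAnn, Thm. 2.3] -/
theorem exactRowDepth_5_neg7_iff_twistSelmer
    (hSW : SteinWuthrich2013_sha_inf_torsionBy_eq_bot_of_two_le_rank)
    (h372 : GrossLMS1991.prop37_2_frobeniusCongruence)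
    (h84 : Literature.NumberTheory.EllipticCurves.WZhang2014_lemma84_exists_minimal_kolyvaginClass_one_selmerCard)
    (K : Type) [Field K] [NumberField K] (hK : IsImaginaryQuadratic K)
    (hD : NumberField.discr K = -7) :
    haveI := isElliptic_of_mem_atlasR3A00 mem_atlas;
    haveI := isGloballyMinimal_of_mem_atlasR3A00 mem_atlas;
    haveI : NeZero ((c5077a1.e.baseChange ℚ).conductorNorm ℤ) := neZero_conductorNorm_of_isElliptic _;
    haveI := Fact.mk (by norm_num : Nat.Prime 5);
    (∃ (Dt : ModularParametrizationData (c5077a1.e.baseChange ℚ) ((c5077a1.e.baseChange ℚ).conductorNorm ℤ)) (β : ℤ) (ι : K →+* ℂ) (n₁ : ℕ)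
      (d : KolyvaginHeegnerData Dt β ι n₁), Squarefree n₁ ∧
        (∀ q ∈ n₁.primeFactors, Zhang2014.IsKolyvaginPrime ((c5077a1.e.baseChange ℚ).conductorNorm ℤ) (c5077a1.e.baseChange ℚ) K 5 q) ∧
        n₁.primeFactors.card + 1 = (c5077a1.e.baseChange ℚ).mordellWeilRank ∧ d.kolyvaginClass (p := 5) (by norm_num) 1 ≠ 0) ↔
    Nat.card (((c5077a1.e.baseChange ℚ).quadraticTwist (NumberField.discr K : ℚ)).selmerGroup (5 : ℕ)) ≤
      5 ^ ((c5077a1.e.baseChange ℚ).mordellWeilRank - 1) := by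
  haveI := isElliptic_of_mem_atlasR3A00 mem_atlas
  haveI := isGloballyMinimal_of_mem_atlasR3A00 mem_atlas
  haveI iNZ : NeZero ((c5077a1.e.baseChange ℚ).conductorNorm ℤ) := neZero_conductorNorm_of_isElliptic _
  haveI i5 := Fact.mk (by norm_num : Nat.Prime 5)
  have hsp := spade_5
  have hKN : ∀ v : HeightOneSpectrum (𝓞 ℚ), (c5077a1.e.baseChange ℚ).HasMultiplicativeReductionAt v →
      ¬ 5 ∣ (c5077a1.e.baseChange ℚ).ordMinimalDiscriminant v :=
    not_dvd_ordMinimalDiscriminant_of_intModel_table intModel (p := 5) (Δ₀ := 5077) (by decide +kernel)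
      (B := 8) (by decide +kernel) (by decide +kernel)
  have hS2 : ¬ Squarefree ((c5077a1.e.baseChange ℚ).conductorNorm ℤ) →
      (∃ (ℓ : ℕ) (_ : Fact ℓ.Prime), (c5077a1.e.baseChange ℚ).HasMultiplicativeReductionAtPrime ℓ ∧
          ¬ 5 ∣ padicValInt ℓ (c5077a1.e.baseChange ℚ).minimalDiscriminantInt) ∧
        ∃ (ℓ₁ ℓ₂ : ℕ) (_ : Fact ℓ₁.Prime) (_ : Fact ℓ₂.Prime), ℓ₁ ≠ ℓ₂ ∧
          (c5077a1.e.baseChange ℚ).HasMultiplicativeReductionAtPrime ℓ₁ ∧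
            (c5077a1.e.baseChange ℚ).HasMultiplicativeReductionAtPrime ℓ₂ :=
    fun hns ↦ absurd ((c5077a1.e.baseChange ℚ).isSemistable_iff_squarefree_conductorNorm.mp hsp.2) hns
  have hH := satisfiesHeegnerHypothesis_conductorNorm_of_intModel intModel K hK.1 hD heegner_neg7
  have hD3 : NumberField.discr K ≠ -3 := by rw [hD]; norm_num
  have hD4 : NumberField.discr K ≠ -4 := by rw [hD]; norm_num
  have hpD : ¬ (((5 : ℕ) : ℤ) ∣ NumberField.discr K) := by rw [hD]; norm_num
  have hr3 : 3 ≤ (c5077a1.e.baseChange ℚ).mordellWeilRank := three_le_rank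
  exact (kolyvaginClass_depth_ne_zero_iff_shaTrivial_twistSelmer_of_lemma84 h372 h84 _ not_hasCM 5 (by norm_num)
    goodOrdinary_5.1 goodOrdinary_5.2 hasSurjectiveModNGaloisRep_pow_5 hKN hsp.1 hS2 K hK hD3 hD4 hpD hH
    (le_trans (by norm_num) hr3)).trans
    (and_iff_right (sha_inf_torsionBy_five_eq_bot hSW))

/-! ## Uniform in the admissible prime: `5077a1` at every good ordinary tower-surjective `5 ≤ p < 1000`, `p ≠ 7` -/

/-- **Kodaira–Néron for `5077a1` at every `p ≥ 5`**: `Δ_min = 5077` has exponent `1` at its only bad prime, so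
`p ∤ ord_v(Δ_min)` at every multiplicative `v`. [cite: CremonaAlgorithms1997, Table 1 (5077a1)] [cite: SilvermanAEC2009, VII.5 Prop. 5.1] -/
theorem kodairaNeron_of_five_le (p : ℕ) (h5 : 5 ≤ p) :
    haveI := isElliptic_of_mem_atlasR3A00 mem_atlas;
    haveI := isGloballyMinimal_of_mem_atlasR3A00 mem_atlas;
    ∀ v : HeightOneSpectrum (𝓞 ℚ), (c5077a1.e.baseChange ℚ).HasMultiplicativeReductionAt v →
      ¬ p ∣ (c5077a1.e.baseChange ℚ).ordMinimalDiscriminant v := by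
  haveI := isElliptic_of_mem_atlasR3A00 mem_atlas
  haveI := isGloballyMinimal_of_mem_atlasR3A00 mem_atlas
  refine not_dvd_ordMinimalDiscriminant_of_intModel_table intModel (p := p) (Δ₀ := 5077) (by decide +kernel)
    (B := 6) (lt_of_lt_of_le (by norm_num) (Nat.pow_le_pow_right (by norm_num) h5)) ?_
  intro q hq hqP hqd; exfalso; have hq6 : q < 6 := Finset.mem_range.mp hq
  interval_cases q <;> first | (norm_num at hqP; done) | exact absurd hqd (by decide)

/-- **♠ (1) for `5077a1` at every prime `p`** (`|Δ_min| = 5077¹`, so `p ∤ v_ℓ(Δ_min) = 1` at the multiplicative prime)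
**and semistability** (`gcd(c₄, Δ) = 1`). [cite: WZhang2014, Hypothesis ♠ (pp. 194–195)] [cite: CremonaAlgorithms1997, Table 1 (5077a1)] -/
theorem spadeOne_of_prime (p : ℕ) [hp : Fact p.Prime] :
    haveI := isElliptic_of_mem_atlasR3A00 mem_atlas;
    haveI := isGloballyMinimal_of_mem_atlasR3A00 mem_atlas;
    (∀ (ℓ : ℕ) [Fact ℓ.Prime], (c5077a1.e.baseChange ℚ).HasMultiplicativeReductionAtPrime ℓ →
      ¬ p ∣ padicValInt ℓ (c5077a1.e.baseChange ℚ).minimalDiscriminantInt) ∧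
      (c5077a1.e.baseChange ℚ).IsSemistable ℤ := by
  haveI := isElliptic_of_mem_atlasR3A00 mem_atlas
  haveI := isGloballyMinimal_of_mem_atlasR3A00 mem_atlas
  exact ⟨not_dvd_padicValInt_of_intModel intModel p
      (forall_prime_dvd_of_natAbs_eq_pow (a := 5077) (i := 1) (by decide +kernel) (by norm_num)
        ⟨1, by decide +kernel, by decide +kernel, Nat.not_dvd_of_pos_of_lt one_pos hp.out.one_lt⟩),
    isSemistable_int_of_intModel_of_isCoprime intModel (by rw [Int.isCoprime_iff_gcd_eq_one]; decide +kernel)⟩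

/-- **`Ш(5077a1/ℚ)[p] = 0` BY NAME at every admissible `5 ≤ p < 1000`** (Stein–Wuthrich 2013 Thm. 1.1: non-CM
`not_hasCM`, `2 ≤ 3 ≤ rank` `three_le_rank`, `N = 5077`; `p` good ordinary and `ρ̄_{E,p}` onto are the hypotheses —
kernel-certified in the tree at `p = 5` only). CONDITIONAL on the named fact; per curve; BSD is not proved by it.
[cite: SteinWuthrich2013, Thm. 1.1 (p. 1758)] -/
theorem sha_inf_torsionBy_eq_bot_at (hSW : SteinWuthrich2013_sha_inf_torsionBy_eq_bot_of_two_le_rank)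
    (p : ℕ) [Fact p.Prime] (h5 : 5 ≤ p) (hp1000 : p < 1000)
    (hgood : haveI := isGloballyMinimal_of_mem_atlasR3A00 mem_atlas; (c5077a1.e.baseChange ℚ).HasGoodReductionAtPrime p)
    (hord : haveI := isGloballyMinimal_of_mem_atlasR3A00 mem_atlas; ¬ (p : ℤ) ∣ (c5077a1.e.baseChange ℚ).frobeniusTrace p)
    (hsurj : (c5077a1.e.baseChange ℚ).HasSurjectiveModNGaloisRep p) :
    haveI := isElliptic_of_mem_atlasR3A00 mem_atlas;
    ((c5077a1.e.baseChange ℚ).sha ⊓ AddSubgroup.torsionBy (c5077a1.e.baseChange ℚ).galH1 (p : ℤ) : AddSubgroup _) = ⊥ := by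
  haveI := isElliptic_of_mem_atlasR3A00 mem_atlas
  haveI := isGloballyMinimal_of_mem_atlasR3A00 mem_atlas
  exact hSW _ not_hasCM (le_trans (by norm_num) three_le_rank) (by rw [conductorNorm_eq]; norm_num)
    p h5 hp1000 hgood hord hsurj

/-- **THE CRUX AT `5077a1` FROM ONE TWIST BOUND AT ANY ADMISSIBLE PRIME.** For every prime `5 ≤ p < 1000`, `p ≠ 7`,
of good ordinary reduction with `ρ_{E,p^n}` onto for all `n` (hypotheses; kernel-certified at `p = 5`), and ONE imaginary
quadratic `K` with `d_K = −7`: IF `#Sel_p(E^{(−7)}/ℚ) ≤ p³` THEN the clause of `KolyvaginDepthSupplyKN` holds at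
`W = 5077a1` verbatim (`p`-uniform side conditions `kodairaNeron_of_five_le`, `spadeOne_of_prime`; SW Thm. 1.1 and W. Zhang
L8.4 (1) by name). The twist `E^{(−7)}` is Gross–Zagier's analytic-rank-ZERO curve, so the datum may be taken at
whichever admissible prime is prime to the algebraic part of `L(E^{(−7)}, 1)` (Kolyvagin / Kato). CONDITIONAL on the two
named facts and the one datum; per curve; BSD is not proved by it. [cite: SteinWuthrich2013, Thm. 1.1 (p. 1758)]
[cite: WZhang2014, Lemma 8.4 (1) (p. 236), Thm. 9.1 (p. 240)] [cite: GrossZagier1986, §V.4] -/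
theorem cruxBody_of_twistSelmer_at
    (hSW : SteinWuthrich2013_sha_inf_torsionBy_eq_bot_of_two_le_rank)
    (h84 : Literature.NumberTheory.EllipticCurves.WZhang2014_lemma84_exists_minimal_kolyvaginClass_one_selmerCard)
    (p : ℕ) [hp : Fact p.Prime] (h5 : 5 ≤ p) (hp1000 : p < 1000) (hp7 : p ≠ 7)
    (hgood : haveI := isGloballyMinimal_of_mem_atlasR3A00 mem_atlas; (c5077a1.e.baseChange ℚ).HasGoodReductionAtPrime p)
    (hord : haveI := isGloballyMinimal_of_mem_atlasR3A00 mem_atlas; ¬ (p : ℤ) ∣ (c5077a1.e.baseChange ℚ).frobeniusTrace p)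
    (htower : ∀ n : ℕ, (c5077a1.e.baseChange ℚ).HasSurjectiveModNGaloisRep (p ^ n : ℕ))
    (K : Type) [Field K] [NumberField K] (hK : IsImaginaryQuadratic K)
    (hD : NumberField.discr K = -7)
    (hT : haveI := isElliptic_of_mem_atlasR3A00 mem_atlas;
      Nat.card (((c5077a1.e.baseChange ℚ).quadraticTwist (NumberField.discr K : ℚ)).selmerGroup p) ≤ p ^ 3) :
    haveI := isElliptic_of_mem_atlasR3A00 mem_atlas;
    haveI := isGloballyMinimal_of_mem_atlasR3A00 mem_atlas;
    ∃ (p : ℕ) (hp : Fact p.Prime), 5 ≤ p ∧ (c5077a1.e.baseChange ℚ).HasGoodReductionAtPrime p ∧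
      ¬ (p : ℤ) ∣ (c5077a1.e.baseChange ℚ).frobeniusTrace p ∧
      (∀ n : ℕ, (c5077a1.e.baseChange ℚ).HasSurjectiveModNGaloisRep (p ^ n : ℕ)) ∧
      (∀ v : HeightOneSpectrum (𝓞 ℚ), (c5077a1.e.baseChange ℚ).HasMultiplicativeReductionAt v →
        ¬ p ∣ (c5077a1.e.baseChange ℚ).ordMinimalDiscriminant v) ∧
      ∃ (K : Type) (_ : Field K) (_ : NumberField K), IsImaginaryQuadratic K ∧
        NumberField.discr K ≠ -3 ∧ NumberField.discr K ≠ -4 ∧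
        ∃ (_ : NeZero ((c5077a1.e.baseChange ℚ).conductorNorm ℤ)),
          SatisfiesHeegnerHypothesis ((c5077a1.e.baseChange ℚ).conductorNorm ℤ) K ∧
        ∃ (Dt : ModularParametrizationData (c5077a1.e.baseChange ℚ) ((c5077a1.e.baseChange ℚ).conductorNorm ℤ))
          (β : ℤ) (ι : K →+* ℂ) (n₁ : ℕ) (d : KolyvaginHeegnerData Dt β ι n₁), Squarefree n₁ ∧
          (∀ q ∈ n₁.primeFactors,
            Zhang2014.IsKolyvaginPrime ((c5077a1.e.baseChange ℚ).conductorNorm ℤ) (c5077a1.e.baseChange ℚ) K p q) ∧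
          d.kolyvaginClass hp.out 1 ≠ 0 ∧
          (n₁.primeFactors.card + 1 ≤ (c5077a1.e.baseChange ℚ).mordellWeilRank ∨
            (n₁.primeFactors.card ≤ (c5077a1.e.baseChange ℚ).mordellWeilRank ∧
              n₁.primeFactors.card + 1 ≤
                ((c5077a1.e.baseChange ℚ).quadraticTwist (NumberField.discr K : ℚ)).mordellWeilRank)) := by
  haveI := isElliptic_of_mem_atlasR3A00 mem_atlas
  haveI := isGloballyMinimal_of_mem_atlasR3A00 mem_atlas
  haveI iNZ : NeZero ((c5077a1.e.baseChange ℚ).conductorNorm ℤ) := neZero_conductorNorm_of_isElliptic _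
  have hsp := spadeOne_of_prime p
  have hH := satisfiesHeegnerHypothesis_conductorNorm_of_intModel intModel K hK.1 hD heegner_neg7
  have hS2 : ¬ Squarefree ((c5077a1.e.baseChange ℚ).conductorNorm ℤ) →
      (∃ (ℓ : ℕ) (_ : Fact ℓ.Prime), (c5077a1.e.baseChange ℚ).HasMultiplicativeReductionAtPrime ℓ ∧
          ¬ p ∣ padicValInt ℓ (c5077a1.e.baseChange ℚ).minimalDiscriminantInt) ∧
        ∃ (ℓ₁ ℓ₂ : ℕ) (_ : Fact ℓ₁.Prime) (_ : Fact ℓ₂.Prime), ℓ₁ ≠ ℓ₂ ∧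
          (c5077a1.e.baseChange ℚ).HasMultiplicativeReductionAtPrime ℓ₁ ∧
            (c5077a1.e.baseChange ℚ).HasMultiplicativeReductionAtPrime ℓ₂ :=
    fun hns ↦ absurd ((c5077a1.e.baseChange ℚ).isSemistable_iff_squarefree_conductorNorm.mp hsp.2) hns
  have hD3 : NumberField.discr K ≠ -3 := by rw [hD]; norm_num
  have hD4 : NumberField.discr K ≠ -4 := by rw [hD]; norm_num
  have hpD : ¬ ((p : ℤ) ∣ NumberField.discr K) := by
    rw [hD]
    intro h
    have h7 : (p : ℤ) ∣ 7 := by simpa using h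
    have hp7' : p ∣ 7 := by exact_mod_cast h7
    rcases (Nat.dvd_prime (by norm_num : Nat.Prime 7)).mp hp7' with h1 | h1
    · exact hp.out.one_lt.ne' h1
    · exact hp7 h1
  have hr3 : 3 ≤ (c5077a1.e.baseChange ℚ).mordellWeilRank := three_le_rank
  have hT' : Nat.card (((c5077a1.e.baseChange ℚ).quadraticTwist (NumberField.discr K : ℚ)).selmerGroup p) ≤
      p ^ (c5077a1.e.baseChange ℚ).mordellWeilRank :=
    le_trans hT (Nat.pow_le_pow_right hp.out.pos hr3)
  exact cruxBody_of_twistSelmer_of_steinWuthrich hSW h84 _ not_hasCM (le_trans (by norm_num) hr3)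
    (by rw [conductorNorm_eq]; norm_num) p h5 hp1000 hgood hord htower (kodairaNeron_of_five_le p h5) hsp.1 hS2
    K hK hD3 hD4 hpD hH hT'

/-- **THE CRUX AT `5077a1` FROM ONE TWIST BOUND AT ANY ADMISSIBLE PRIME AND ANY HEEGNER FIELD.** For every prime
`5 ≤ p < 1000` of good ordinary reduction with `ρ_{E,p^n}` onto for all `n` (hypotheses), and ANY imaginary quadratic
`K` satisfying the Heegner hypothesis for `N = 5077` with `d_K ∉ {−3, −4}` and `p ∤ d_K`: IF `#Sel_p(E^{(d_K)}/ℚ) ≤ p³`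
THEN the clause of `KolyvaginDepthSupplyKN` holds at `W = 5077a1` verbatim. The kit may choose BOTH the prime and the
field — e.g. any `K` in which `5077` splits with `L(E^{(d_K)}, 1) ≠ 0` and a prime `p` not dividing the algebraic part of
that value (Kolyvagin / Kato then give `Sel_p(E^{(d_K)}) = 0`). CONDITIONAL on SW Thm. 1.1 and W. Zhang L8.4 (1) by
name and the one datum; per curve; BSD is not proved by it. [cite: SteinWuthrich2013, Thm. 1.1 (p. 1758)]
[cite: WZhang2014, Lemma 8.4 (1) (p. 236), Thm. 9.1 (p. 240)] -/
theorem cruxBody_of_twistSelmer_at_of_heegner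
    (hSW : SteinWuthrich2013_sha_inf_torsionBy_eq_bot_of_two_le_rank)
    (h84 : Literature.NumberTheory.EllipticCurves.WZhang2014_lemma84_exists_minimal_kolyvaginClass_one_selmerCard)
    (p : ℕ) [hp : Fact p.Prime] (h5 : 5 ≤ p) (hp1000 : p < 1000)
    (hgood : haveI := isGloballyMinimal_of_mem_atlasR3A00 mem_atlas; (c5077a1.e.baseChange ℚ).HasGoodReductionAtPrime p)
    (hord : haveI := isGloballyMinimal_of_mem_atlasR3A00 mem_atlas; ¬ (p : ℤ) ∣ (c5077a1.e.baseChange ℚ).frobeniusTrace p)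
    (htower : ∀ n : ℕ, (c5077a1.e.baseChange ℚ).HasSurjectiveModNGaloisRep (p ^ n : ℕ))
    (K : Type) [Field K] [NumberField K] (hK : IsImaginaryQuadratic K)
    (hD3 : NumberField.discr K ≠ -3) (hD4 : NumberField.discr K ≠ -4) (hpD : ¬ ((p : ℤ) ∣ NumberField.discr K))
    (hH : haveI := isElliptic_of_mem_atlasR3A00 mem_atlas;
      haveI : NeZero ((c5077a1.e.baseChange ℚ).conductorNorm ℤ) := neZero_conductorNorm_of_isElliptic _;
      SatisfiesHeegnerHypothesis ((c5077a1.e.baseChange ℚ).conductorNorm ℤ) K)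
    (hT : haveI := isElliptic_of_mem_atlasR3A00 mem_atlas;
      Nat.card (((c5077a1.e.baseChange ℚ).quadraticTwist (NumberField.discr K : ℚ)).selmerGroup p) ≤ p ^ 3) :
    haveI := isElliptic_of_mem_atlasR3A00 mem_atlas;
    haveI := isGloballyMinimal_of_mem_atlasR3A00 mem_atlas;
    ∃ (p : ℕ) (hp : Fact p.Prime), 5 ≤ p ∧ (c5077a1.e.baseChange ℚ).HasGoodReductionAtPrime p ∧
      ¬ (p : ℤ) ∣ (c5077a1.e.baseChange ℚ).frobeniusTrace p ∧
      (∀ n : ℕ, (c5077a1.e.baseChange ℚ).HasSurjectiveModNGaloisRep (p ^ n : ℕ)) ∧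
      (∀ v : HeightOneSpectrum (𝓞 ℚ), (c5077a1.e.baseChange ℚ).HasMultiplicativeReductionAt v →
        ¬ p ∣ (c5077a1.e.baseChange ℚ).ordMinimalDiscriminant v) ∧
      ∃ (K : Type) (_ : Field K) (_ : NumberField K), IsImaginaryQuadratic K ∧
        NumberField.discr K ≠ -3 ∧ NumberField.discr K ≠ -4 ∧
        ∃ (_ : NeZero ((c5077a1.e.baseChange ℚ).conductorNorm ℤ)),
          SatisfiesHeegnerHypothesis ((c5077a1.e.baseChange ℚ).conductorNorm ℤ) K ∧
        ∃ (Dt : ModularParametrizationData (c5077a1.e.baseChange ℚ) ((c5077a1.e.baseChange ℚ).conductorNorm ℤ))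
          (β : ℤ) (ι : K →+* ℂ) (n₁ : ℕ) (d : KolyvaginHeegnerData Dt β ι n₁), Squarefree n₁ ∧
          (∀ q ∈ n₁.primeFactors,
            Zhang2014.IsKolyvaginPrime ((c5077a1.e.baseChange ℚ).conductorNorm ℤ) (c5077a1.e.baseChange ℚ) K p q) ∧
          d.kolyvaginClass hp.out 1 ≠ 0 ∧
          (n₁.primeFactors.card + 1 ≤ (c5077a1.e.baseChange ℚ).mordellWeilRank ∨
            (n₁.primeFactors.card ≤ (c5077a1.e.baseChange ℚ).mordellWeilRank ∧
              n₁.primeFactors.card + 1 ≤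
                ((c5077a1.e.baseChange ℚ).quadraticTwist (NumberField.discr K : ℚ)).mordellWeilRank)) := by
  haveI := isElliptic_of_mem_atlasR3A00 mem_atlas
  haveI := isGloballyMinimal_of_mem_atlasR3A00 mem_atlas
  haveI iNZ : NeZero ((c5077a1.e.baseChange ℚ).conductorNorm ℤ) := neZero_conductorNorm_of_isElliptic _
  have hsp := spadeOne_of_prime p
  have hS2 : ¬ Squarefree ((c5077a1.e.baseChange ℚ).conductorNorm ℤ) →
      (∃ (ℓ : ℕ) (_ : Fact ℓ.Prime), (c5077a1.e.baseChange ℚ).HasMultiplicativeReductionAtPrime ℓ ∧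
          ¬ p ∣ padicValInt ℓ (c5077a1.e.baseChange ℚ).minimalDiscriminantInt) ∧
        ∃ (ℓ₁ ℓ₂ : ℕ) (_ : Fact ℓ₁.Prime) (_ : Fact ℓ₂.Prime), ℓ₁ ≠ ℓ₂ ∧
          (c5077a1.e.baseChange ℚ).HasMultiplicativeReductionAtPrime ℓ₁ ∧
            (c5077a1.e.baseChange ℚ).HasMultiplicativeReductionAtPrime ℓ₂ :=
    fun hns ↦ absurd ((c5077a1.e.baseChange ℚ).isSemistable_iff_squarefree_conductorNorm.mp hsp.2) hns
  have hr3 : 3 ≤ (c5077a1.e.baseChange ℚ).mordellWeilRank := three_le_rank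
  have hT' : Nat.card (((c5077a1.e.baseChange ℚ).quadraticTwist (NumberField.discr K : ℚ)).selmerGroup p) ≤
      p ^ (c5077a1.e.baseChange ℚ).mordellWeilRank :=
    le_trans hT (Nat.pow_le_pow_right hp.out.pos hr3)
  exact cruxBody_of_twistSelmer_of_steinWuthrich hSW h84 _ not_hasCM (le_trans (by norm_num) hr3)
    (by rw [conductorNorm_eq]; norm_num) p h5 hp1000 hgood hord htower (kodairaNeron_of_five_le p h5) hsp.1 hS2
    K hK hD3 hD4 hpD hH hT'

/-! ## The crux at `5077a1` from ONE `L`-value valuation (Skinner 2016 Thm. C on Gross–Zagier's twist) -/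

/-- **THE CRUX `KolyvaginDepthSupplyKN` AT GROSS–ZAGIER'S RANK-THREE CURVE `5077a1` FROM ONE EXACT `L`-VALUE.** Granted
FOUR named print facts — Stein–Wuthrich 2013 Thm. 1.1 (`Ш(E)[5] = 0`), W. Zhang 2014 Lemma 8.4 (1) / Thm. 9.1 (the level-one
class), Skinner 2016 Thm. C (the `5`-part of BSD for the rank-zero twist) and Gross–Zagier–Kolyvagin (rank `0`, finite `Ш` of the
twist) — the CLAUSE of the crux holds at `W = 5077a1` VERBATIM as soon as the twist `T = E^{(−7)}` (minimal model
`[0,0,1,−343,−2144]`, conductor `248 773`) has `L(T, 1) ≠ 0` and the rational number `L(T,1)/Ω_T` has `5`-adic valuation `≤ 0`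
— ONE modular-symbol computation on a rank-ZERO curve (numerically `L(T,1) ≈ 4.48`). Chain: `…TwistLValue`
(`natCard_selmerGroup_quadraticTwist_neg7_eq_one_of_LValue`: `#Sel_5(E^{(−7)}) = 1`) and `cruxBody_of_twistSelmer` (part 1).
The anticyclotomic depth door at the first rank-3 curve, read through the cyclotomic main conjecture of its rank-0 twist.
CONDITIONAL on the four named facts and the two `L`-value hypotheses; per curve (the open stub (S♭) is untouched); BSD is not
proved by it. [cite: SteinWuthrich2013, Thm. 1.1 (p. 1758)] [cite: WZhang2014, Lemma 8.4 (1) (p. 236), Thm. 9.1 (p. 240)]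
[cite: Skinner2016PacificMC, Thm. C (p. 173)] [cite: Darmon2004, Thm. 3.22] [cite: GrossZagier1986, §V.4] -/
theorem cruxBody_of_twistLValue
    (hSW : SteinWuthrich2013_sha_inf_torsionBy_eq_bot_of_two_le_rank)
    (h84 : Literature.NumberTheory.EllipticCurves.WZhang2014_lemma84_exists_minimal_kolyvaginClass_one_selmerCard)
    (hSk : Skinner2016_padicValRat_bsd_rank_zero) (hGZK : rank_eq_analyticRank_of_analyticRank_le_one)
    (K : Type) [Field K] [NumberField K] (hK : IsImaginaryQuadratic K) (hD : NumberField.discr K = -7)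
    (hL : haveI := isElliptic_twist7;
      ((⟨0, 0, 1, -343, -2144⟩ : WeierstrassCurve ℤ).map (Int.castRingHom ℚ)).entireLFunction 1 ≠ 0)
    (hval : haveI := isElliptic_twist7; haveI := isGloballyMinimal_twist7;
      ∀ q : ℚ, ((⟨0, 0, 1, -343, -2144⟩ : WeierstrassCurve ℤ).map (Int.castRingHom ℚ)).entireLFunction 1 /
          ((((⟨0, 0, 1, -343, -2144⟩ : WeierstrassCurve ℤ).map (Int.castRingHom ℚ)).realPeriodRat : ℝ) : ℂ) = (q : ℂ) →
        padicValRat 5 q ≤ 0) :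
    haveI := isElliptic_of_mem_atlasR3A00 mem_atlas;
    haveI := isGloballyMinimal_of_mem_atlasR3A00 mem_atlas;
    ∃ (p : ℕ) (hp : Fact p.Prime), 5 ≤ p ∧ (c5077a1.e.baseChange ℚ).HasGoodReductionAtPrime p ∧
      ¬ (p : ℤ) ∣ (c5077a1.e.baseChange ℚ).frobeniusTrace p ∧
      (∀ n : ℕ, (c5077a1.e.baseChange ℚ).HasSurjectiveModNGaloisRep (p ^ n : ℕ)) ∧
      (∀ v : HeightOneSpectrum (𝓞 ℚ), (c5077a1.e.baseChange ℚ).HasMultiplicativeReductionAt v →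
        ¬ p ∣ (c5077a1.e.baseChange ℚ).ordMinimalDiscriminant v) ∧
      ∃ (K : Type) (_ : Field K) (_ : NumberField K), IsImaginaryQuadratic K ∧
        NumberField.discr K ≠ -3 ∧ NumberField.discr K ≠ -4 ∧
        ∃ (_ : NeZero ((c5077a1.e.baseChange ℚ).conductorNorm ℤ)),
          SatisfiesHeegnerHypothesis ((c5077a1.e.baseChange ℚ).conductorNorm ℤ) K ∧
        ∃ (Dt : ModularParametrizationData (c5077a1.e.baseChange ℚ) ((c5077a1.e.baseChange ℚ).conductorNorm ℤ))
          (β : ℤ) (ι : K →+* ℂ) (n₁ : ℕ) (d : KolyvaginHeegnerData Dt β ι n₁), Squarefree n₁ ∧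
          (∀ q ∈ n₁.primeFactors,
            Zhang2014.IsKolyvaginPrime ((c5077a1.e.baseChange ℚ).conductorNorm ℤ) (c5077a1.e.baseChange ℚ) K p q) ∧
          d.kolyvaginClass hp.out 1 ≠ 0 ∧
          (n₁.primeFactors.card + 1 ≤ (c5077a1.e.baseChange ℚ).mordellWeilRank ∨
            (n₁.primeFactors.card ≤ (c5077a1.e.baseChange ℚ).mordellWeilRank ∧
              n₁.primeFactors.card + 1 ≤
                ((c5077a1.e.baseChange ℚ).quadraticTwist (NumberField.discr K : ℚ)).mordellWeilRank)) := by
  haveI := isElliptic_of_mem_atlasR3A00 mem_atlas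
  haveI := isGloballyMinimal_of_mem_atlasR3A00 mem_atlas
  have h1 := natCard_selmerGroup_quadraticTwist_neg7_eq_one_of_LValue hSk hGZK hL hval
  refine cruxBody_of_twistSelmer hSW h84 K hK hD ?_
  have hcast : (NumberField.discr K : ℚ) = (-7 : ℚ) := by rw [hD]; norm_num
  rw [hcast, h1]
  norm_num

end C5077a1

end Summit.BirchSwinnertonDyer.BirchSwinnertonDyer.Theorems.KolyvaginDepthDoor

end
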